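import Summits.QuantumFields.YangMills.Theorems.BalabanUVNodesN15CurvedGluingCubeDressedGeneralRows
import Summits.QuantumFields.YangMills.Theorems.BalabanUVNodesN15CurvedGluingCubeDressedGeneralCommutator
import Summits.QuantumFields.YangMills.Theorems.BalabanUVNodesN15TwoSpacingGluingInputLocalized
import HarnessLib

/-!
# Route «BalabanUVNodes» (cluster K4 «SpineRates»), Track-A DAG node N15 = NE2, BACKGROUND LAYER — THE REMAINDER's COMMUTATOR ROW FOR THE GENERAL DRESSED CUBE: the FLAT half
# `[Δ_flat, M_h]∘X` BY NAME (dag-n15-c FILE 46's Leibniz row on files 23∕25's two-sided entries), and its assembly with the nonlocal flat summand (FILE 57) and the dressed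
# perturbation's half (file 26) into FILE 58's one-sided `hKc` shape `[Δ_flat + N − 𝒱, M_h]∘X ≤ 1_S(y′)·θ₀·e^{−ρd}`

Cell `pub-ymgap`, seat `pub-ymgap-dag-n15-w4` (WIDTH SEAT 4 on node N15, director-ym №197∕R399 (3a) ∕ HUMAN RULING D-0149; dag-n15-w3 g3's located item (h) of HOME
`pub-ymgap-dag-n15-w3/HANDOFF.md` §«What remains after g3», released to width seats I.29986, GO by the lineage's successor dag-n15-w3 g4 I.30233).  `bears_on: R4∕N15 · K3⁷
SpineGivenEndpointR13SepCoPH (stmt-QuantumFields-20544)`.  Filed `--kind proof --supports stmt-QuantumFields-20544 --as helper` — COUNT-NEUTRAL.  Theorems only; 0 `sorry`.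
Imports BY NAME dag-n15-w3 file 25 `…N15CurvedGluingCubeDressedGeneralRows` (`hasMaj_projO_dressedV_loc₂`; through it file 23 `hasMaj_dressedV_pair`, `hasMaj_dressedV_loc₂`,
`projO_some_dressedV`), file 26 `…N15CurvedGluingCubeDressedGeneralCommutator` (`jet_comp_mulOp`, `hasMaj_commOp_dressedPert_comp_in`), dag-n15-c FILE 46 `…N15TwoSpacingGluingCommutator`
(`lapOp`, `hasMaj_commOp_lapOp_comp`, through file 23's imports) and FILE 57 `…N15TwoSpacingGluingInputLocalized` (`hasMaj_commOp_comp_of_add`); lit `B11SectG` (`HasMaj`, `hasMaj_zero`),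
`T4EtaRateCoeffDefect` (`diagK`, `hasMaj_mulOp`); nothing in the tree is modified, nothing of FILES 43–69 or files 12–28 re-declared.

WHY.  dag-n15-c FILE 58 `gluedLetters_of_cubeRows_in` consumes, per cube, the ONE-SIDED remainder row `hKc : [Δ, M_{h_i}]∘G_i ≤ 1_{S_i}(y′)·θ₀e^{−δd}` of the operator `Δ` being
inverted.  For dag-n15-w3's GENERAL dressed cube (file 23: `X = pr₀X̂`, `X̂ = bgPropV (stack G₀ D) V̂`, an arbitrary decaying perturbation `V̂` of the forward∕backward 1-jet, cube operator
`Δ_flat − 𝒱` with `𝒱 = V̂∘jet` — file 23 `mulOp_comp_sub_comp_dressedV_of_defect`) the row splits ([B6] (2.91)–(2.92) p. 239 «Using the formulas (1.126)–(1.128)»):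
`[Δ_flat + N − 𝒱, M_h]∘X = [Σ∇*∇ + W, M_h]∘X + [N, M_h]∘X − [𝒱, M_h]∘X`.  The last is file 26 (LANDED); the first is FILE 46's lattice-Leibniz row, which wants the cube's TWO-SIDED
entries `X, ∇^±_μX ≤ 1_S1_S·βe^{−δd}` — for the dressed cube these are file 23 `hasMaj_dressedV_loc₂` (entry 0) and file 25 `hasMaj_projO_dressedV_loc₂` at the jet's components `±μ` read
through file 23 `projO_some_dressedV` (`pr_{±μ}X̂ = ∇^±_μ∘X`); the middle is FILE 57's one-sided row for a flat NONLOCAL summand `N` with FILE 56's letter `[N, M_h] ≤ c_N·e^{−ρ_Nd}`.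
THIS FILE types the first and assembles all three in FILE 58's exact shape, with the two adapters the concrete jet needs for file 26 (its Leibniz remainder's diagonal letter and its reading
of the partition against a block constant) — so that a live-background knit (dag-n15-c's (Γ15)) feeds `gluedLetters_of_cubeRows_in` per dressed cube by name:
* §1 `commOp_sub_left`; ★ `hasMaj_jetRem_diagK` (`D_h = (0, (M_{∇⁺_μh})_μ, (M_{∇⁻_μh})_μ) ≤ diagK c₁` from `|∇^±_μh| ≤ c₁`), ★ `abs_jetReading_sub_le` (the jet's reading `a` of `h` is within
  `ω + ℓd₁` of the block constant `hb` when `h` is within `ω`, `hb` is `ℓ`-block-Lipschitz and one lattice step moves a block by `≤ d₁`);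
* §2 ★★ `hasMaj_commOp_lapOp_dressedV_loc₂` — THE FLAT HALF, two-sided: `[Σ_μ∇*_μ∇_μ + W, M_h]∘X ≤ 1_S(y)1_S(y′)·(|J|(c₂ + 2c₁)β(1 − βRc_r²)⁻¹ + θ_W)·e^{−ρ₂d}` from the flat cube's data
  (`G₀, D_j ≤ βe^{−δd}`, cut-offs over `S`, `D_j = Dq_j∘G₀` with `Dq` the forward∕backward jet), the perturbation's `V̂ ≤ Re^{−δ_Vd}`, `βRc_r² < 1`, the partition's `|∇^±_μh| ≤ c₁`,
  `|∇*_μ∇_μh| ≤ c₂` and the block-local `W`-row `θ_W` (displayed, as in FILE 46);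
* §3 ★★★ `hasMaj_commOp_cubeOp_dressedV_in` — FILE 58's `hKc` FOR THE DRESSED CUBE: `[Σ∇*∇ + W + N − 𝒱, M_h]∘X ≤ 1_S(y′)·θ₀·e^{−ρ₃d}`,
  `θ₀ = |J|(c₂ + 2c₁)β′ + θ_W + c_Nβ′c_r + ((ℓ(eε)⁻¹ + 2(ω + ℓd₁))R + Rc₁)β′c_r`, `β′ = β(1 − βRc_r²)⁻¹` — every constant small when the partition varies slowly (`c₁, c₂, ℓ, ω, θ_W, c_N`
  carry the `O(M⁻¹)`) or the perturbation is small (`R`).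
The η-defect twins (FILE 58's `hDK`) are the sequel file `…RemainderRowDefect`.

HONEST FRAMING ∕ LIMITS.  Finite-dimensional operator algebra + block-majorant bookkeeping over DISPLAYED letters: the flat cube `G₀`, its derived pieces and cut-offs, the perturbation's
decay letter `R, δ_V` (for `P₁(A)` this is [B9] (3.77)), the partition's `c₁, c₂, ℓ, ω` (dischargeable for the sampled (2.36) profile by dag-n15-c FILES 61∕64 and this seat's
`…N15PartitionTwoGridFitSecond` by name — not done here), the flat `W`∕`N` commutator letters (FILE 56 `hasMaj_commOp_nonlocal` produces `c_N` from a kernel letter); [B6] (2.91)–(2.92) p. 239,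
(2.133)–(2.134) p. 247, [B5] (1.120)–(1.128) pp. 37–38, [B9] (3.62)–(3.65) pp. 402–403 ∕ (3.76)–(3.77) pp. 405–406 = SHAPES ∕ MECHANISM — nothing of [B5]∕[B6]∕[B9] asserted.  NE2⁺ NOT
PRINTED, NOT proved; N15 NOT discharged; counts of record UNMOVED (typed 28∕28 · discharged 5∕27); no summit statement is proved here; one finite 𝕋⁴ at fixed ε — NOT infinite volume, NOT OS
on ℝ⁴, NOT a mass gap, NOT Clay; R4 closes the conditional finite-𝕋⁴ rung `BalabanLadder.UV` only.  Restate-immune (no Theses import).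
-/

set_option autoImplicit false

noncomputable section
open scoped BigOperators
open Finset

namespace Summit.QuantumFields.YangMills.BalabanUVNodes.N15.CurvedSpecies

open Literature.MathematicalPhysics.QuantumFieldTheory.Balaban1983to89
open Literature.MathematicalPhysics.QuantumFieldTheory.Balaban1983to89.B11SectG (BlockNorm HasMaj RowSum hasMaj_zero hasMaj_comp_exp)
open Literature.MathematicalPhysics.QuantumFieldTheory.Balaban1983to89.B6RandomWalk (Triangle254)
open Literature.MathematicalPhysics.QuantumFieldTheory.Balaban1983to89.T4EtaRateCoeffDefect (diagK diagK_nonneg hasMaj_mulOp)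
open Literature.MathematicalPhysics.QuantumFieldTheory.Balaban1983to89.B6Prop26Gluing (mulOp mulOp_apply ind ind_nonneg ind_le_one ind_of_mem)
open Summit.QuantumFields.YangMills.BalabanUVNodes.N15.MatrixSpecies (liftBlk liftEquiv liftEquiv_apply liftEquiv_symm_apply)
open Summit.QuantumFields.YangMills.BalabanUVNodes.N15.BackgroundModel (kappa_ofBlocks)
open Summit.QuantumFields.YangMills.BalabanUVNodes.N15.BackgroundLayer (fgrad bgrad fgradAdj fgrad_apply bgrad_apply stack projO blkPair hasMaj_stack hasMaj_projO_comp bgPropV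
  projO_none_comp_stack projO_some_comp_stack)
open Summit.QuantumFields.YangMills.BalabanUVNodes.N15.Gluing (commOp lapOp hasMaj_commOp_lapOp_comp hasMaj_commOp_comp_of_add)

/-! ## §1 Algebra, and the two adapters of the concrete forward∕backward jet -/

section Algebra

variable {Y : Type}

/-- `[Δ₁ − Δ₂, M_a] = [Δ₁, M_a] − [Δ₂, M_a]`. [folklore] -/
theorem commOp_sub_left (Δ₁ Δ₂ : (Y → ℝ) →ₗ[ℝ] (Y → ℝ)) (a : Y → ℝ) : commOp (Δ₁ - Δ₂) a = commOp Δ₁ a - commOp Δ₂ a := by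
  rw [commOp, commOp, commOp, LinearMap.sub_comp, LinearMap.comp_sub]
  abel

end Algebra

section Jet

variable {X ι J : Type} [Fintype X] [DecidableEq X] [Fintype ι] [DecidableEq ι] [Fintype J] [DecidableEq J] {g : B6.Geometry} (blk : X → g.Site) (τ : J → X ≃ X) (n : ℝ)

omit [DecidableEq X] [DecidableEq ι] [DecidableEq J] in
/-- ★ **THE JET's LEIBNIZ REMAINDER IS DIAGONAL**: `D_h = (0, (M_{∇⁺_μh})_μ, (M_{∇⁻_μh})_μ)` (file 26 `jet_comp_mulOp`) has the majorant `diagK c₁` from the partition's `|∇^±_μh| ≤ c₁` — file 26's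
`hDh` for the concrete forward∕backward jet. [cite: Balaban1984PropagatorsII, p.229 («|∂h_□| ≤ O(1)(ML^jη)⁻¹»: shape), p.239 («Using the formulas (1.126)–(1.128)»)] -/
theorem hasMaj_jetRem_diagK {h : X × ι → ℝ} {c₁ : ℝ} (hc₁ : 0 ≤ c₁) (hh1 : ∀ μ p, |fgrad n (liftEquiv (τ μ) ι) h p| ≤ c₁) (hh1b : ∀ μ p, |bgrad n (liftEquiv (τ μ) ι) h p| ≤ c₁) :
    HasMaj (BlockNorm.ofBlocks g (liftBlk blk ι)) (BlockNorm.ofBlocks g (blkPair (liftBlk blk ι)))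
      (stack 0 (fun j : J ⊕ J => Sum.elim (fun μ => mulOp (fgrad n (liftEquiv (τ μ) ι) h)) (fun μ => mulOp (bgrad n (liftEquiv (τ μ) ι) h)) j)) (diagK fun _ => c₁) := by
  refine hasMaj_stack (liftBlk blk ι) (diagK_nonneg fun _ => hc₁) ((hasMaj_zero _ _).mono fun y y' => diagK_nonneg (fun _ => hc₁) y y') fun j => ?_
  rcases j with μ | μ
  · exact hasMaj_mulOp (liftBlk blk ι) (m := fun _ => c₁) (fun _ => hc₁) (hh1 μ)
  · exact hasMaj_mulOp (liftBlk blk ι) (m := fun _ => c₁) (fun _ => hc₁) (hh1b μ)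

omit [Fintype X] [DecidableEq X] [Fintype ι] [DecidableEq ι] [Fintype J] [DecidableEq J] in
/-- ★ **THE JET's READING OF THE PARTITION AGAINST A BLOCK CONSTANT**: if `h` is within `ω` of the block constant `hb`, `hb` is `ℓ`-block-Lipschitz and one lattice step `τ_μ` moves a block by at most
`d₁`, then the jet's reading `a(p, none) = h(p)`, `a(p, ±μ) = h(τ_μ^{±1}p)` (file 26 `jet_comp_mulOp`) is within `ω + ℓd₁` of `hb` read at the base point — file 26's `hra` for the concrete jet.
[cite: Balaban1984PropagatorsI, (1.120)–(1.121) p.37 (block-Lipschitz partition: shape)] -/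
theorem abs_jetReading_sub_le (hsymm : ∀ y y', g.dist y y' = g.dist y' y) {h : X × ι → ℝ} {hb : g.Site → ℝ} {ℓ ω d₁ : ℝ} (hℓ : 0 ≤ ℓ) (hd₁ : 0 ≤ d₁)
    (hLip : ∀ y y', |hb y - hb y'| ≤ ℓ * g.dist y y') (hrh : ∀ p, |h p - hb (liftBlk blk ι p)| ≤ ω) (hstep : ∀ μ x, g.dist (blk (τ μ x)) (blk x) ≤ d₁)
    (q : (X × ι) × Option (J ⊕ J)) :
    |Option.elim q.2 (h q.1) (fun j => Sum.elim (fun μ => h (liftEquiv (τ μ) ι q.1)) (fun μ => h ((liftEquiv (τ μ) ι).symm q.1)) j) - hb (blkPair (liftBlk blk ι) q)| ≤ ω + ℓ * d₁ := by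
  have hℓd : 0 ≤ ℓ * d₁ := mul_nonneg hℓ hd₁
  have key : ∀ x x' : X, ∀ i : ι, g.dist (blk x') (blk x) ≤ d₁ → |h (x', i) - hb (blk x)| ≤ ω + ℓ * d₁ := fun x x' i hxx' => by
    have h1 := hrh (x', i)
    have h2 := hLip (blk x') (blk x)
    have h3 : ℓ * g.dist (blk x') (blk x) ≤ ℓ * d₁ := mul_le_mul_of_nonneg_left hxx' hℓ
    calc |h (x', i) - hb (blk x)| = |(h (x', i) - hb (blk x')) + (hb (blk x') - hb (blk x))| := by ring_nf
      _ ≤ |h (x', i) - hb (blk x')| + |hb (blk x') - hb (blk x)| := abs_add_le _ _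
      _ ≤ ω + ℓ * d₁ := add_le_add h1 (h2.trans h3)
  obtain ⟨p, _ | j⟩ := q
  · exact (hrh p).trans (le_add_of_nonneg_right hℓd)
  · rcases j with μ | μ
    · exact key p.1 (τ μ p.1) p.2 (hstep μ p.1)
    · have hs : g.dist (blk ((τ μ).symm p.1)) (blk p.1) ≤ d₁ := by
        have := hstep μ ((τ μ).symm p.1)
        rw [Equiv.apply_symm_apply] at this
        rwa [hsymm]
      exact key p.1 ((τ μ).symm p.1) p.2 hs

end Jet

/-! ## §2 The flat half `[Σ_μ∇*_μ∇_μ + W, M_h]∘X`, two-sided, for the general dressed cube -/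

section Flat

variable {X ι J : Type} [Fintype X] [DecidableEq X] [Fintype ι] [DecidableEq ι] [Fintype J] [DecidableEq J] {g : B6.Geometry} (blk : X → g.Site) (τ : J → X ≃ X) (n : ℝ)
  {σ cr : ℝ} {G₀ : (X × ι → ℝ) →ₗ[ℝ] (X × ι → ℝ)} {D Dq : J ⊕ J → (X × ι → ℝ) →ₗ[ℝ] (X × ι → ℝ)} {V : ((X × ι) × Option (J ⊕ J) → ℝ) →ₗ[ℝ] (X × ι → ℝ)}

/-- ★★ **THE FLAT HALF OF THE REMAINDER ROW, TWO-SIDED** (dag-n15-w3's located (h)): for the general dressed cube `X = pr₀(bgPropV (stack G₀ D) V̂)` of file 23 — flat cube `G₀, D_j ≤ βe^{−δd}`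
with the output cut-off `M_χG₀ = G₀`, `M_χD_j = D_j` and the input cut-off `G₀M_ψ = G₀` over `S`, `D_j = Dq_j∘G₀` for the forward∕backward jet `Dq_{+μ} = ∇⁺_μ`, `Dq_{−μ} = ∇⁻_μ`, perturbation
`V̂ ≤ Re^{−δ_Vd}`, `βRc_r² < 1` — and a partition function `h` with `|∇^±_μh| ≤ c₁`, `|∇*_μ∇_μh| ≤ c₂` and block-local `W`-row `[W, M_h]∘X ≤ 1_S1_S·θ_We^{−ρ₂d}`:
`[Σ_μ∇*_μ∇_μ + W, M_h]∘X ≤ 1_S(y)1_S(y′)·(|J|(c₂β′ + 2c₁β′) + θ_W)·e^{−ρ₂d}`, `β′ = β(1 − βRc_r²)⁻¹` — dag-n15-c FILE 46 `hasMaj_commOp_lapOp_comp` on files 23∕25's two-sided entries.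
[cite: Balaban1984PropagatorsII, (2.92) p.239, (2.133)–(2.134) p.247 (shapes + mechanism); Balaban1985BackgroundPropagators, (3.62)–(3.65) pp.402–403] -/
theorem hasMaj_commOp_lapOp_dressedV_loc₂ (htri : Triangle254 g) (hd : ∀ a b : g.Site, 0 ≤ g.dist a b) (hrow : RowSum g σ cr) (hσ : 0 ≤ σ) {ρ₁ ρ₂ δ δV β R c₁ c₂ θW : ℝ}
    (hβ : 0 ≤ β) (hR : 0 ≤ R) (hcr : 0 ≤ cr) (hσρ : σ ≤ ρ₁) (hρ₁V : ρ₁ ≤ δV) (hρ₁G : ρ₁ + σ ≤ δ) (hρ₂ : 0 ≤ ρ₂) (hρ₂₁ : ρ₂ + σ ≤ ρ₁) (hc₁ : 0 ≤ c₁) (hc₂ : 0 ≤ c₂)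
    (hDqf : ∀ μ, Dq (Sum.inl μ) = fgrad n (liftEquiv (τ μ) ι)) (hDqb : ∀ μ, Dq (Sum.inr μ) = bgrad n (liftEquiv (τ μ) ι)) (hDq : ∀ j, D j = Dq j ∘ₗ G₀)
    {S : Set g.Site} {χX ψX : X → ℝ} (hSχ : ∀ x, χX x ≠ 0 → blk x ∈ S) (hSψ : ∀ x, ψX x ≠ 0 → blk x ∈ S) (hGχ : mulOp (fun p : X × ι => χX p.1) ∘ₗ G₀ = G₀)
    (hDχ : ∀ j, mulOp (fun p : X × ι => χX p.1) ∘ₗ D j = D j) (hGψ : G₀ ∘ₗ mulOp (fun p : X × ι => ψX p.1) = G₀) {W : (X × ι → ℝ) →ₗ[ℝ] (X × ι → ℝ)} {h : X × ι → ℝ}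
    (hh1 : ∀ μ p, |fgrad n (liftEquiv (τ μ) ι) h p| ≤ c₁) (hh1b : ∀ μ p, |bgrad n (liftEquiv (τ μ) ι) h p| ≤ c₁)
    (hh2 : ∀ μ p, |fgradAdj n (liftEquiv (τ μ) ι) (fgrad n (liftEquiv (τ μ) ι) h) p| ≤ c₂)
    (hG : HasMaj (BlockNorm.ofBlocks g (liftBlk blk ι)) (BlockNorm.ofBlocks g (liftBlk blk ι)) G₀ (fun y y' => β * Real.exp (-(δ * g.dist y y'))))
    (hD : ∀ j, HasMaj (BlockNorm.ofBlocks g (liftBlk blk ι)) (BlockNorm.ofBlocks g (liftBlk blk ι)) (D j) (fun y y' => β * Real.exp (-(δ * g.dist y y'))))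
    (hV : HasMaj (BlockNorm.ofBlocks g (blkPair (liftBlk blk ι))) (BlockNorm.ofBlocks g (liftBlk blk ι)) V (fun y y' => R * Real.exp (-(δV * g.dist y y'))))
    (hq : β * (R * cr) * cr < 1)
    (hW : HasMaj (BlockNorm.ofBlocks g (liftBlk blk ι)) (BlockNorm.ofBlocks g (liftBlk blk ι)) (commOp W h ∘ₗ (projO none ∘ₗ bgPropV (stack G₀ D) V))
      (fun y y' => ind S y * ind S y' * (θW * Real.exp (-(ρ₂ * g.dist y y'))))) :
    HasMaj (BlockNorm.ofBlocks g (liftBlk blk ι)) (BlockNorm.ofBlocks g (liftBlk blk ι))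
      (commOp (lapOp n (fun μ => liftEquiv (τ μ) ι) W) h ∘ₗ (projO none ∘ₗ bgPropV (stack G₀ D) V))
      (fun y y' => ind S y * ind S y' * ((Fintype.card J * (c₂ * (β * (1 - β * (R * cr) * cr)⁻¹) + 2 * (c₁ * (β * (1 - β * (R * cr) * cr)⁻¹))) + θW) *
        Real.exp (-(ρ₂ * g.dist y y')))) := by
  obtain ⟨hunit, -⟩ := hasMaj_dressedV_pair blk htri hd hrow hσ hβ hR hcr hσρ hρ₁V hρ₁G hρ₂ hρ₂₁ hG hD hV hq
  have hG0 := hasMaj_dressedV_loc₂ blk htri hd hrow hσ hβ hR hcr hσρ hρ₁V hρ₁G hρ₂ hρ₂₁ hSχ hSψ hGχ hGψ hDq hG hD hV hq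
  have hcomp : ∀ j : J ⊕ J, HasMaj (BlockNorm.ofBlocks g (liftBlk blk ι)) (BlockNorm.ofBlocks g (liftBlk blk ι)) (Dq j ∘ₗ (projO none ∘ₗ bgPropV (stack G₀ D) V))
      (fun y y' => ind S y * ind S y' * (β * (1 - β * (R * cr) * cr)⁻¹ * Real.exp (-(ρ₂ * g.dist y y')))) := fun j => by
    have hψ' : mulOp (fun p : X × ι => χX p.1) ∘ₗ (projO (some j) ∘ₗ stack G₀ D) = projO (some j) ∘ₗ stack G₀ D := by
      rw [projO_some_comp_stack]; exact hDχ j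
    have key := hasMaj_projO_dressedV_loc₂ blk htri hd hrow hσ hβ hR hcr hσρ hρ₁V hρ₁G hρ₂ hρ₂₁ hDq (some j) hSχ hSψ hψ' hGψ hG hD hV hq
    rwa [projO_some_dressedV hDq hunit j] at key
  have hDf : ∀ μ, HasMaj (BlockNorm.ofBlocks g (liftBlk blk ι)) (BlockNorm.ofBlocks g (liftBlk blk ι)) (fgrad n (liftEquiv (τ μ) ι) ∘ₗ (projO none ∘ₗ bgPropV (stack G₀ D) V))
      (fun y y' => ind S y * ind S y' * (β * (1 - β * (R * cr) * cr)⁻¹ * Real.exp (-(ρ₂ * g.dist y y')))) := fun μ => by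
    simpa only [hDqf] using hcomp (Sum.inl μ)
  have hDb : ∀ μ, HasMaj (BlockNorm.ofBlocks g (liftBlk blk ι)) (BlockNorm.ofBlocks g (liftBlk blk ι)) (bgrad n (liftEquiv (τ μ) ι) ∘ₗ (projO none ∘ₗ bgPropV (stack G₀ D) V))
      (fun y y' => ind S y * ind S y' * (β * (1 - β * (R * cr) * cr)⁻¹ * Real.exp (-(ρ₂ * g.dist y y')))) := fun μ => by
    simpa only [hDqb] using hcomp (Sum.inr μ)
  exact hasMaj_commOp_lapOp_comp (liftBlk blk ι) hc₁ hc₂ hh1 hh1b hh2 hG0 hDf hDb hW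

end Flat

/-! ## §3 FILE 58's `hKc` for the dressed cube: `[Σ∇*∇ + W + N − 𝒱, M_h]∘X`, input-localized -/

section Row

variable {X ι J : Type} [Fintype X] [DecidableEq X] [Fintype ι] [DecidableEq ι] [Fintype J] [DecidableEq J] {g : B6.Geometry} (blk : X → g.Site) (τ : J → X ≃ X) (n : ℝ)
  {σ cr : ℝ} {G₀ : (X × ι → ℝ) →ₗ[ℝ] (X × ι → ℝ)} {D Dq : J ⊕ J → (X × ι → ℝ) →ₗ[ℝ] (X × ι → ℝ)} {V : ((X × ι) × Option (J ⊕ J) → ℝ) →ₗ[ℝ] (X × ι → ℝ)}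

/-- ★★★ **THE REMAINDER's COMMUTATOR ROW OF THE DRESSED CUBE, FILE 58's `hKc` SHAPE**: with the data of `hasMaj_commOp_lapOp_dressedV_loc₂`, a flat NONLOCAL summand `N` through its commutator
letter `[N, M_h] ≤ c_N·e^{−ρ_Nd}` (FILE 56 `hasMaj_commOp_nonlocal`), and for the dressed perturbation's half (file 26) the partition within `ω` of an `ℓ`-block-Lipschitz block constant `hb`,
one lattice step moving a block by `≤ d₁`, symmetric distance, `ε > 0`, rates `ρ₃ ≤ ρ₂`, `ρ₃ + σ ≤ δ_V − ε`, `ρ₃ + σ ≤ ρ_N`: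
`[Σ∇*∇ + W + N − 𝒱, M_h]∘X ≤ 1_S(y′)·θ₀·e^{−ρ₃d}`, `θ₀ = |J|(c₂β′ + 2c₁β′) + θ_W + c_Nβ′c_r + ((ℓ(eε)⁻¹ + 2(ω + ℓd₁))Rβ′c_r + Rc₁β′c_r)`, `β′ = β(1 − βRc_r²)⁻¹` (`𝒱 = V̂∘jet`).
[cite: Balaban1984PropagatorsII, (2.91)–(2.92) p.239, (2.133)–(2.134) p.247 (shapes + mechanism); Balaban1984PropagatorsI, (1.120)–(1.128) pp.37–38; Balaban1985BackgroundPropagators, (3.62)–(3.65) pp.402–403, (3.76)–(3.77) pp.405–406] -/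
theorem hasMaj_commOp_cubeOp_dressedV_in (htri : Triangle254 g) (hd : ∀ a b : g.Site, 0 ≤ g.dist a b) (hsymm : ∀ y y', g.dist y y' = g.dist y' y) (hrow : RowSum g σ cr) (hσ : 0 ≤ σ)
    {ρ₁ ρ₂ ρ₃ ρN δ δV ε β R c₁ c₂ θW cN ℓ ω d₁ : ℝ} (hβ : 0 ≤ β) (hR : 0 ≤ R) (hcr : 0 ≤ cr) (hσρ : σ ≤ ρ₁) (hρ₁V : ρ₁ ≤ δV) (hρ₁G : ρ₁ + σ ≤ δ) (hρ₂ : 0 ≤ ρ₂)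
    (hρ₂₁ : ρ₂ + σ ≤ ρ₁) (hρ₃ : 0 ≤ ρ₃) (hρ₃₂ : ρ₃ ≤ ρ₂) (hρ₃V : ρ₃ + σ ≤ δV - ε) (hρ₃N : ρ₃ + σ ≤ ρN) (hε : 0 < ε) (hc₁ : 0 ≤ c₁) (hc₂ : 0 ≤ c₂) (hθW : 0 ≤ θW)
    (hcN : 0 ≤ cN) (hℓ : 0 ≤ ℓ) (hω : 0 ≤ ω) (hd₁ : 0 ≤ d₁)
    (hDqf : ∀ μ, Dq (Sum.inl μ) = fgrad n (liftEquiv (τ μ) ι)) (hDqb : ∀ μ, Dq (Sum.inr μ) = bgrad n (liftEquiv (τ μ) ι)) (hDq : ∀ j, D j = Dq j ∘ₗ G₀)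
    {S : Set g.Site} {χX ψX : X → ℝ} (hSχ : ∀ x, χX x ≠ 0 → blk x ∈ S) (hSψ : ∀ x, ψX x ≠ 0 → blk x ∈ S) (hGχ : mulOp (fun p : X × ι => χX p.1) ∘ₗ G₀ = G₀)
    (hDχ : ∀ j, mulOp (fun p : X × ι => χX p.1) ∘ₗ D j = D j) (hGψ : G₀ ∘ₗ mulOp (fun p : X × ι => ψX p.1) = G₀) {W N : (X × ι → ℝ) →ₗ[ℝ] (X × ι → ℝ)}
    {h : X × ι → ℝ} {hb : g.Site → ℝ}
    (hh1 : ∀ μ p, |fgrad n (liftEquiv (τ μ) ι) h p| ≤ c₁) (hh1b : ∀ μ p, |bgrad n (liftEquiv (τ μ) ι) h p| ≤ c₁)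
    (hh2 : ∀ μ p, |fgradAdj n (liftEquiv (τ μ) ι) (fgrad n (liftEquiv (τ μ) ι) h) p| ≤ c₂)
    (hLip : ∀ y y', |hb y - hb y'| ≤ ℓ * g.dist y y') (hrh : ∀ p, |h p - hb (liftBlk blk ι p)| ≤ ω) (hstep : ∀ μ x, g.dist (blk (τ μ x)) (blk x) ≤ d₁)
    (hG : HasMaj (BlockNorm.ofBlocks g (liftBlk blk ι)) (BlockNorm.ofBlocks g (liftBlk blk ι)) G₀ (fun y y' => β * Real.exp (-(δ * g.dist y y'))))
    (hD : ∀ j, HasMaj (BlockNorm.ofBlocks g (liftBlk blk ι)) (BlockNorm.ofBlocks g (liftBlk blk ι)) (D j) (fun y y' => β * Real.exp (-(δ * g.dist y y'))))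
    (hV : HasMaj (BlockNorm.ofBlocks g (blkPair (liftBlk blk ι))) (BlockNorm.ofBlocks g (liftBlk blk ι)) V (fun y y' => R * Real.exp (-(δV * g.dist y y'))))
    (hq : β * (R * cr) * cr < 1)
    (hW : HasMaj (BlockNorm.ofBlocks g (liftBlk blk ι)) (BlockNorm.ofBlocks g (liftBlk blk ι)) (commOp W h ∘ₗ (projO none ∘ₗ bgPropV (stack G₀ D) V))
      (fun y y' => ind S y * ind S y' * (θW * Real.exp (-(ρ₂ * g.dist y y')))))
    (hKN : HasMaj (BlockNorm.ofBlocks g (liftBlk blk ι)) (BlockNorm.ofBlocks g (liftBlk blk ι)) (commOp N h) (fun y y' => cN * Real.exp (-(ρN * g.dist y y')))) :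
    HasMaj (BlockNorm.ofBlocks g (liftBlk blk ι)) (BlockNorm.ofBlocks g (liftBlk blk ι))
      (commOp (lapOp n (fun μ => liftEquiv (τ μ) ι) W + N - V ∘ₗ stack LinearMap.id Dq) h ∘ₗ (projO none ∘ₗ bgPropV (stack G₀ D) V))
      (fun y y' => ind S y' * (((Fintype.card J * (c₂ * (β * (1 - β * (R * cr) * cr)⁻¹) + 2 * (c₁ * (β * (1 - β * (R * cr) * cr)⁻¹))) + θW
        + cN * (β * (1 - β * (R * cr) * cr)⁻¹) * cr)
        + ((ℓ * (Real.exp 1 * ε)⁻¹ + 2 * (ω + ℓ * d₁)) * R * (β * (1 - β * (R * cr) * cr)⁻¹) * cr + R * c₁ * (β * (1 - β * (R * cr) * cr)⁻¹) * cr)) *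
        Real.exp (-(ρ₃ * g.dist y y')))) := by
  obtain ⟨hunit, hX⟩ := hasMaj_dressedV_pair blk htri hd hrow hσ hβ hR hcr hσρ hρ₁V hρ₁G hρ₂ hρ₂₁ hG hD hV hq
  have hB : 0 ≤ β * (1 - β * (R * cr) * cr)⁻¹ := mul_nonneg hβ (inv_nonneg.2 (by linarith))
  -- the flat local half, two-sided (§2), and the dressed entry 0
  have hflat := hasMaj_commOp_lapOp_dressedV_loc₂ blk τ n htri hd hrow hσ hβ hR hcr hσρ hρ₁V hρ₁G hρ₂ hρ₂₁ hc₁ hc₂ hDqf hDqb hDq hSχ hSψ hGχ hDχ hGψ hh1 hh1b hh2 hG hD hV hq hW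
  have hG0 := hasMaj_dressedV_loc₂ blk htri hd hrow hσ hβ hR hcr hσρ hρ₁V hρ₁G hρ₂ hρ₂₁ hSχ hSψ hGχ hGψ hDq hG hD hV hq
  -- add the flat nonlocal summand (FILE 57)
  have hθ : 0 ≤ Fintype.card J * (c₂ * (β * (1 - β * (R * cr) * cr)⁻¹) + 2 * (c₁ * (β * (1 - β * (R * cr) * cr)⁻¹))) + θW := by positivity
  have h1 := hasMaj_commOp_comp_of_add (liftBlk blk ι) htri hd hrow hθ hcN hB hρ₃ hρ₃₂ hρ₃N hflat hKN hG0
  -- subtract the dressed perturbation's half (file 26), the concrete jet's `hjet`∕`hDh`∕`hra` supplied by §1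
  have hDqE : Dq = fun j : J ⊕ J => Sum.elim (fun μ => fgrad n (liftEquiv (τ μ) ι)) (fun μ => bgrad n (liftEquiv (τ μ) ι)) j := by
    funext j
    rcases j with μ | μ
    · exact hDqf μ
    · exact hDqb μ
  subst hDqE
  have hjet := jet_comp_mulOp (ι := ι) τ n h
  have hra := abs_jetReading_sub_le blk τ hsymm hℓ hd₁ hLip hrh hstep
  have hω' : 0 ≤ ω + ℓ * d₁ := add_nonneg hω (mul_nonneg hℓ hd₁)
  have hrh' : ∀ p, |h p - hb (liftBlk blk ι p)| ≤ ω + ℓ * d₁ := fun p => (hrh p).trans (le_add_of_nonneg_right (mul_nonneg hℓ hd₁))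
  have hDh := hasMaj_jetRem_diagK blk τ n hc₁ hh1 hh1b
  have h2 := hasMaj_commOp_dressedPert_comp_in blk htri hd hsymm hrow hR hB hℓ hω' hε hc₁ hcr hρ₃ hρ₃₂ hρ₃V hjet hDq hunit hSψ hGψ hLip hra hrh' hV hDh hX
  rw [commOp_sub_left, LinearMap.sub_comp]
  refine (h1.sub h2).mono fun y y' => le_of_eq ?_
  ring

end Row

end Summit.QuantumFields.YangMills.BalabanUVNodes.N15.CurvedSpecies

end
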